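import Literature.AlgebraicGeometry.Resolution.RegularFormalFibresPolynomial
import Literature.AlgebraicGeometry.Resolution.DimensionFormula
import Literature.AlgebraicGeometry.Resolution.CohenMacaulayCatenary
import Literature.AlgebraicGeometry.Resolution.AdicQuotient
import Mathlib.RingTheory.Ideal.MinimalPrime.Localization
import HarnessLib

/-!
# Quotients of regular local rings are formally equidimensional

Topic: `Literature/AlgebraicGeometry/Resolution`. Pure commutative algebra serving Cossart–Piltant
2019, proof of journal Prop. 4.8 = arXiv v1 Prop. 4.6 (p. 53): for the quasi-excellent local
domain `A` with completion `Â` and a minimal prime `P̂₁` of `Â`,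

> "We have `r ≤ d := dim(Â/P̂₁)`. … Since `k_v | k` is algebraic and `Â/P̂₁` is universally
> catenary, we have `d = dim 𝒪_{Ŷ,ŷ}`."

For the local rings `A = 𝒪_{X,x}` of schemes of finite type over a field (quotients of regular
local rings) one has in fact `d = dim A` for EVERY minimal prime of `Â`: such rings are
*formally equidimensional* (Ratliff; EGA IV 7.1.x; Matsumura §31). This is what allows the
hypothesis "(LU) for complete local domains of dimension three" (`CossartPiltant2019LUComplete3`,
dimension EXACTLY three) to be applied to `Â/P̂₁` when `dim A = 3`.

We PROVE it for quotients `A = S/J` of regular local rings `S` by primes `J` (and anything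
isomorphic to such a quotient):

* `height_eq_of_mem_minimalPrimes_map_adicCompletion` — for a minimal prime `Q` of `JŜ`,
  `ht Q = ht J` (going down along the flat `S → Ŝ`, Matsumura Thm. 15.1);
* `ringKrullDim_quotient_eq_of_mem_minimalPrimes_map_adicCompletion` — `dim Ŝ/Q = dim S/J`
  (`Ŝ` is a regular local ring of dimension `dim S`, hence a catenary domain:
  `dim Ŝ = ht Q + dim Ŝ/Q` and `dim S = ht J + dim S/J`);
* `ringKrullDim_quotient_eq_of_mem_minimalPrimes_adicCompletion_quotient` — for every minimal
  prime `P` of `(S/J)^ ≅ Ŝ/JŜ` (Matsumura Thm. 8.11, `quotientCompletionEquiv`),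
  `dim (S/J)^/P = dim S/J`;
* `forall_ringKrullDim_quotient_minimalPrimes_of_ringEquiv` — transport of the property
  "every minimal prime has quotient of dimension `d`" along ring isomorphisms, and
  `ringKrullDim_quotient_eq_of_mem_minimalPrimes_adicCompletion_of_ringEquiv` — the statement
  for any Noetherian local ring isomorphic to some `S/J`.

Everything is PROVED; no definitions, no named facts.

## Sources

* V. Cossart, O. Piltant, J. Algebra 529 (2019) 268–535 = arXiv:1412.0868, proof of Prop. 4.8
  (arXiv v1: Prop. 4.6, p. 53). [CossartPiltant2019]
* H. Matsumura, *Commutative Ring Theory* (1986), Thm. 15.1, Thm. 8.11, Thm. 17.4, §31.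
  [Matsumura1987]
* A. Grothendieck, EGA IV₂, §7.1 (formally equidimensional = quasi-unmixed local rings).
-/

noncomputable section

open IsLocalRing

namespace Literature.AlgebraicGeometry.Resolution

universe u

/-! ## Transport along ring isomorphisms -/

section Transport

variable {R R' : Type u} [CommRing R] [CommRing R']

/-- Minimal primes correspond under a ring isomorphism. [folklore] -/
theorem comap_mem_minimalPrimes_of_ringEquiv (e : R ≃+* R') {P : Ideal R'}
    (hP : P ∈ minimalPrimes R') : P.comap (e : R →+* R') ∈ minimalPrimes R := by
  have h := Ideal.minimalPrimes_comap_of_surjective (f := (e : R →+* R')) e.surjective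
    (I := (⊥ : Ideal R')) hP
  have hbot : (⊥ : Ideal R').comap (e : R →+* R') = ⊥ := by
    rw [← RingHom.ker_eq_comap_bot]
    exact (RingHom.injective_iff_ker_eq_bot _).mp e.injective
  rwa [hbot] at h

/-- The quotients by corresponding primes are isomorphic, hence have the same dimension.
[folklore] -/
theorem ringKrullDim_quotient_comap_ringEquiv (e : R ≃+* R') (P : Ideal R') :
    ringKrullDim (R ⧸ P.comap (e : R →+* R')) = ringKrullDim (R' ⧸ P) := by
  refine ringKrullDim_eq_of_ringEquiv (Ideal.quotientEquiv (P.comap (e : R →+* R')) P e ?_)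
  rw [Ideal.map_comap_of_surjective (e : R →+* R') e.surjective]

/-- **Transport of formal equidimensionality-type statements along isomorphisms**: if every
minimal prime of `R` has quotient of dimension `d`, so does every minimal prime of `R' ≅ R`.
[folklore] -/
theorem forall_ringKrullDim_quotient_minimalPrimes_of_ringEquiv (e : R ≃+* R') {d : WithBot ℕ∞}
    (h : ∀ P ∈ minimalPrimes R, ringKrullDim (R ⧸ P) = d) :
    ∀ P ∈ minimalPrimes R', ringKrullDim (R' ⧸ P) = d := fun P hP => by
  rw [← ringKrullDim_quotient_comap_ringEquiv e P]
  exact h _ (comap_mem_minimalPrimes_of_ringEquiv e hP)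

end Transport

/-! ## Minimal primes of `JŜ` for a regular local `S` -/

section Regular

variable {S : Type u} [CommRing S] [IsRegularLocalRing S] (J : Ideal S) [J.IsPrime]

/-- **`ht Q = ht J` for a minimal prime `Q` of `JŜ`** (`S` Noetherian local, `S → Ŝ` flat, hence
going-down; `Q` lies over `J` and `Q/JŜ` is a minimal prime; Matsumura Thm. 15.1).
[cite: Matsumura1987, Thm. 15.1] -/
theorem height_eq_of_mem_minimalPrimes_map_adicCompletion
    {Q : Ideal (AdicCompletion (maximalIdeal S) S)}
    (hQ : Q ∈ (J.map (algebraMap S (AdicCompletion (maximalIdeal S) S))).minimalPrimes) :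
    Q.height = J.height := by
  set B := AdicCompletion (maximalIdeal S) S
  haveI : IsNoetherianRing B := isNoetherianRing_adicCompletion_maximalIdeal S
  haveI : Q.IsPrime := hQ.1.1
  haveI : Q.LiesOver J := ⟨(under_eq_of_mem_minimalPrimes_map J hQ).symm⟩
  rw [Ideal.height_eq_height_add_of_liesOver_of_hasGoingDown J Q]
  set I := J.map (algebraMap S B) with hI
  obtain ⟨P₀, hP₀, hP₀Q⟩ : ∃ P₀ ∈ minimalPrimes (B ⧸ I), Ideal.comap (Ideal.Quotient.mk I) P₀ = Q := by
    have h := hQ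
    rw [Ideal.minimalPrimes_eq_comap] at h
    exact h
  haveI : P₀.IsPrime := hP₀.1.1
  have hmap : Q.map (Ideal.Quotient.mk I) = P₀ := by
    rw [← hP₀Q, Ideal.map_comap_of_surjective _ Ideal.Quotient.mk_surjective]
  rw [hmap, Ideal.height_eq_zero_iff.mpr hP₀, add_zero]

/-- **`dim Ŝ/Q = dim S/J` for a minimal prime `Q` of `JŜ`, `S` regular local, `J` prime.** The
completion `Ŝ` is a regular local ring (`isRegularLocalRing_adicCompletion`) of dimension `dim S`
(`ringKrullDim_adicCompletion`), hence a catenary Noetherian local domain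
(`isCatenaryRing_of_isRegularLocalRing`), so `dim Ŝ = ht Q + dim Ŝ/Q`; likewise
`dim S = ht J + dim S/J`; and `ht Q = ht J`. [cite: Matsumura1987, Thm. 15.1]
[cite: Matsumura1987, Thm. 17.4] -/
theorem ringKrullDim_quotient_eq_of_mem_minimalPrimes_map_adicCompletion
    {Q : Ideal (AdicCompletion (maximalIdeal S) S)}
    (hQ : Q ∈ (J.map (algebraMap S (AdicCompletion (maximalIdeal S) S))).minimalPrimes) :
    ringKrullDim (AdicCompletion (maximalIdeal S) S ⧸ Q) = ringKrullDim (S ⧸ J) := by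
  set B := AdicCompletion (maximalIdeal S) S
  haveI : IsRegularLocalRing B := isRegularLocalRing_adicCompletion S
  haveI : IsDomain B := isDomain_of_isRegularLocalRing B
  haveI : IsDomain S := isDomain_of_isRegularLocalRing S
  haveI : Q.IsPrime := hQ.1.1
  -- the dimension formulas in the catenary local domains `Ŝ` and `S`
  have hcatB : IsCatenaryRing B := isCatenaryRing_of_isRegularLocalRing B
  have hcatS : IsCatenaryRing S := isCatenaryRing_of_isRegularLocalRing S
  have hB := hcatB.height_eq_height_add_height_map_quotientMk (le_maximalIdeal hQ.1.1.ne_top)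
  have hS := hcatS.height_eq_height_add_height_map_quotientMk (le_maximalIdeal ‹J.IsPrime›.ne_top)
  -- `𝔪.map mk = 𝔪` of the quotient, whose height is the dimension of the quotient
  haveI : Nontrivial (B ⧸ Q) := Ideal.Quotient.nontrivial_iff.mpr hQ.1.1.ne_top
  haveI : Nontrivial (S ⧸ J) := Ideal.Quotient.nontrivial_iff.mpr ‹J.IsPrime›.ne_top
  haveI : IsLocalRing (B ⧸ Q) := IsLocalRing.of_surjective' _ Ideal.Quotient.mk_surjective
  haveI : IsLocalRing (S ⧸ J) := IsLocalRing.of_surjective' _ Ideal.Quotient.mk_surjective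
  have hmB : (maximalIdeal B).map (Ideal.Quotient.mk Q) = maximalIdeal (B ⧸ Q) :=
    IsLocalRing.map_maximalIdeal_of_surjective _ Ideal.Quotient.mk_surjective
  have hmS : (maximalIdeal S).map (Ideal.Quotient.mk J) = maximalIdeal (S ⧸ J) :=
    IsLocalRing.map_maximalIdeal_of_surjective _ Ideal.Quotient.mk_surjective
  rw [hmB] at hB
  rw [hmS] at hS
  -- `ht 𝔪_Ŝ = ht 𝔪_S` and `ht Q = ht J`
  have hmm : (maximalIdeal B).height = (maximalIdeal S).height :=
    height_maximalIdeal_adicCompletion S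
  have hQJ : Q.height = J.height := height_eq_of_mem_minimalPrimes_map_adicCompletion J hQ
  rw [hmm, hQJ, hS] at hB
  -- cancel the finite `ht J`
  haveI : IsNoetherianRing B := inferInstance
  have hJfin : J.height ≠ ⊤ := Ideal.height_ne_top ‹J.IsPrime›.ne_top
  have hcancel : (maximalIdeal (B ⧸ Q)).height = (maximalIdeal (S ⧸ J)).height :=
    ENat.add_right_injective_of_ne_top hJfin hB.symm
  rw [← IsLocalRing.maximalIdeal_height_eq_ringKrullDim,
    ← IsLocalRing.maximalIdeal_height_eq_ringKrullDim, hcancel]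

/-- **Quotients of regular local rings by primes are formally equidimensional**: for `S`
regular local and `J` prime, every minimal prime `P` of the completion `(S/J)^` satisfies
`dim (S/J)^/P = dim S/J`. (Completion commutes with quotients, `(S/J)^ ≅ Ŝ/JŜ`, Matsumura
Thm. 8.11 = `quotientCompletionEquiv`; the minimal primes of `Ŝ/JŜ` are the `Q/JŜ` for the
minimal primes `Q` of `JŜ`, and `(Ŝ/JŜ)/(Q/JŜ) ≅ Ŝ/Q`.) [cite: Matsumura1987, Thm. 8.11]
[cite: Matsumura1987, Thm. 15.1] -/
theorem ringKrullDim_quotient_eq_of_mem_minimalPrimes_adicCompletion_quotient [IsLocalRing (S ⧸ J)] :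
    ∀ P ∈ minimalPrimes (AdicCompletion (maximalIdeal (S ⧸ J)) (S ⧸ J)),
      ringKrullDim (AdicCompletion (maximalIdeal (S ⧸ J)) (S ⧸ J) ⧸ P) = ringKrullDim (S ⧸ J) := by
  set B := AdicCompletion (maximalIdeal S) S
  haveI : IsNoetherianRing B := isNoetherianRing_adicCompletion_maximalIdeal S
  set I := J.map (algebraMap S B) with hI
  have hmS : (maximalIdeal S).map (Ideal.Quotient.mk J) = maximalIdeal (S ⧸ J) :=
    IsLocalRing.map_maximalIdeal_of_surjective _ Ideal.Quotient.mk_surjective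
  -- `Ŝ/JŜ ≅ (S/J)^`
  have e₀ : (B ⧸ I) ≃+* AdicCompletion ((maximalIdeal S).map (Ideal.Quotient.mk J)) (S ⧸ J) :=
    quotientCompletionEquiv (maximalIdeal S) J
  rw [hmS] at e₀
  -- every minimal prime of `Ŝ/JŜ` has quotient of dimension `dim S/J`
  refine forall_ringKrullDim_quotient_minimalPrimes_of_ringEquiv e₀ fun P₀ hP₀ => ?_
  haveI : P₀.IsPrime := hP₀.1.1
  set Q : Ideal B := P₀.comap (Ideal.Quotient.mk I) with hQdef
  have hQ : Q ∈ I.minimalPrimes := by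
    rw [Ideal.minimalPrimes_eq_comap]
    exact ⟨P₀, hP₀, rfl⟩
  have hIQ : I ≤ Q := hQ.1.2
  have hP₀eq : P₀ = Q.map (Ideal.Quotient.mk I) := by
    rw [hQdef, Ideal.map_comap_of_surjective _ Ideal.Quotient.mk_surjective]
  rw [hP₀eq, ringKrullDim_eq_of_ringEquiv (DoubleQuot.quotQuotEquivQuotOfLE hIQ)]
  exact ringKrullDim_quotient_eq_of_mem_minimalPrimes_map_adicCompletion J hQ

end Regular

/-! ## Any Noetherian local ring isomorphic to a prime quotient of a regular local ring -/

/-- **Formal equidimensionality of local rings presented as prime quotients of regular local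
rings** (e.g. the local rings of schemes of finite type over a field, or over `ℤ`, or over a
complete local ring): if `A ≅ S/J` with `S` regular local and `J` prime, then for every minimal
prime `P` of `Â`, `dim Â/P = dim A`. (In Cossart–Piltant's proof of Prop. 4.8 this makes
`d := dim Â/P̂₁` equal to `dim A = 3`.) [cite: Matsumura1987, Thm. 15.1]
[cite: CossartPiltant2019, proof of Prop. 4.8 (arXiv v1: Prop. 4.6, p. 53)] -/
theorem ringKrullDim_quotient_eq_of_mem_minimalPrimes_adicCompletion_of_ringEquiv
    {A : Type u} [CommRing A] [IsLocalRing A] [IsNoetherianRing A]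
    {S : Type u} [CommRing S] [IsRegularLocalRing S] (J : Ideal S) [J.IsPrime] (e : A ≃+* S ⧸ J) :
    ∀ P ∈ minimalPrimes (AdicCompletion (maximalIdeal A) A),
      ringKrullDim (AdicCompletion (maximalIdeal A) A ⧸ P) = ringKrullDim A := by
  haveI : Nontrivial (S ⧸ J) := Ideal.Quotient.nontrivial_iff.mpr ‹J.IsPrime›.ne_top
  haveI : IsLocalRing (S ⧸ J) := IsLocalRing.of_surjective' _ Ideal.Quotient.mk_surjective
  haveI : IsNoetherianRing (S ⧸ J) := inferInstance
  -- `Â ≅ (S/J)^` along `e`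
  have he : (maximalIdeal A).map e.toRingHom = maximalIdeal (S ⧸ J) :=
    IsLocalRing.map_maximalIdeal_of_surjective e.toRingHom e.surjective
  let ê : AdicCompletion (maximalIdeal A) A ≃+* AdicCompletion (maximalIdeal (S ⧸ J)) (S ⧸ J) :=
    adicCompletionCongr (maximalIdeal A) (maximalIdeal (S ⧸ J)) e he
  have h := forall_ringKrullDim_quotient_minimalPrimes_of_ringEquiv ê.symm
    (ringKrullDim_quotient_eq_of_mem_minimalPrimes_adicCompletion_quotient J)
  intro P hP
  rw [h P hP]
  exact (ringKrullDim_eq_of_ringEquiv e).symm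

/-! ## Local rings of algebras of finite type over regular rings: presentation as `S/J` -/

section Presentation

variable {R B : Type u} [CommRing R] [CommRing B] (f : R →+* B) (hf : Function.Surjective f)
  (p : Ideal B) [p.IsPrime]

include hf in
/-- **Localisation commutes with quotients**, in the form needed here: for a surjection
`f : R → B` and a prime `𝔭` of `B` with preimage `𝔮`, the induced local homomorphism
`R_𝔮 → B_𝔭` is surjective with kernel `(ker f) R_𝔮`, so `B_𝔭 ≅ R_𝔮 / (ker f) R_𝔮`.
[folklore] -/
theorem exists_ringEquiv_localization_quotient_map_ker :
    Nonempty (Localization.AtPrime p ≃+*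
      Localization.AtPrime (p.comap f) ⧸
        (RingHom.ker f).map (algebraMap R (Localization.AtPrime (p.comap f)))) := by
  set q : Ideal R := p.comap f with hqdef
  set S := Localization.AtPrime q
  let g : S →+* Localization.AtPrime p := Localization.localRingHom q p f rfl
  -- `g` is surjective
  have hg : Function.Surjective g := by
    intro z
    obtain ⟨b, s, rfl⟩ := IsLocalization.exists_mk'_eq p.primeCompl z
    obtain ⟨r, hr⟩ := hf b
    obtain ⟨t, ht⟩ := hf (s : B)
    have htq : t ∈ q.primeCompl := fun h => s.2 (by rw [← ht]; exact h)
    refine ⟨IsLocalization.mk' S r ⟨t, htq⟩, ?_⟩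
    rw [Localization.localRingHom_mk', hr]
    congr 1
    exact Subtype.ext ht
  -- with kernel `(ker f) S`
  have hker : RingHom.ker g = (RingHom.ker f).map (algebraMap R S) := by
    apply le_antisymm
    · intro x hx
      obtain ⟨r, t, rfl⟩ := IsLocalization.exists_mk'_eq q.primeCompl x
      rw [RingHom.mem_ker, Localization.localRingHom_mk', IsLocalization.mk'_eq_zero_iff] at hx
      obtain ⟨⟨u, hu⟩, hu'⟩ := hx
      obtain ⟨v, rfl⟩ := hf u
      have hvq : v ∈ q.primeCompl := fun h => hu h
      -- `f (v r) = 0`, so `v r ∈ ker f`, and `r/t = (v r)/(v t)`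
      have hvr : v * r ∈ RingHom.ker f := by
        rw [RingHom.mem_ker, map_mul]
        exact hu'
      have heq : IsLocalization.mk' S r t = IsLocalization.mk' S (v * r) (⟨v, hvq⟩ * t) := by
        rw [IsLocalization.mk'_eq_iff_eq]
        congr 1
        simp only [Submonoid.coe_mul]
        ring
      rw [heq]
      exact (IsLocalization.mk'_mem_map_algebraMap_iff q.primeCompl S _ _ _).mpr
        ⟨1, Submonoid.one_mem _, by rw [one_mul]; exact hvr⟩
    · rw [Ideal.map_le_iff_le_comap]
      intro r hr
      rw [Ideal.mem_comap, RingHom.mem_ker, Localization.localRingHom_to_map,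
        RingHom.mem_ker.mp hr, map_zero]
  have e₁ : S ⧸ RingHom.ker g ≃+* Localization.AtPrime p := RingHom.quotientKerEquivOfSurjective hg
  have e₂ : S ⧸ (RingHom.ker f).map (algebraMap R S) ≃+* S ⧸ RingHom.ker g :=
    Ideal.quotEquivOfEq hker.symm
  exact ⟨(e₂.trans e₁).symm⟩

end Presentation

/-- **Local rings of algebras of finite type over a regular ring are formally equidimensional**
(when domains): for `B` a domain of finite type over a regular ring `R₀` (a field, `ℤ`, a
complete regular local ring, …) and a prime `𝔭` of `B`, every minimal prime `P` of the completion
of `A = B_𝔭` has `dim Â/P = dim A`. (`A ≅ R_𝔮/I R_𝔮` for a presentation `B = R/I`,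
`R = R₀[x₁, …, x_n]` regular, `I` prime; apply
`ringKrullDim_quotient_eq_of_mem_minimalPrimes_adicCompletion_of_ringEquiv`.) In Cossart–Piltant's
proof of Prop. 4.8 for `A = 𝒪_{X,x}` with `dim A = 3` this gives `dim Â/P̂₁ = 3` for every
minimal prime, as needed to invoke (LU) for complete local domains of dimension three.
[cite: Matsumura1987, Thm. 15.1] [cite: CossartPiltant2019, proof of Prop. 4.8 (arXiv v1: Prop. 4.6, p. 53)] -/
theorem ringKrullDim_quotient_eq_of_mem_minimalPrimes_adicCompletion_localization
    (R₀ : Type u) [CommRing R₀] [IsRegularRing R₀] {B : Type u} [CommRing B] [IsDomain B]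
    [Algebra R₀ B] [Algebra.FiniteType R₀ B] (p : Ideal B) [p.IsPrime] :
    ∀ P ∈ minimalPrimes (AdicCompletion (maximalIdeal (Localization.AtPrime p))
        (Localization.AtPrime p)),
      ringKrullDim (AdicCompletion (maximalIdeal (Localization.AtPrime p))
        (Localization.AtPrime p) ⧸ P) = ringKrullDim (Localization.AtPrime p) := by
  obtain ⟨n, φ, hφ⟩ := Algebra.FiniteType.iff_quotient_mvPolynomial''.mp ‹Algebra.FiniteType R₀ B›
  set R := MvPolynomial (Fin n) R₀
  haveI : IsNoetherianRing B := Algebra.FiniteType.isNoetherianRing R₀ B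
  haveI : IsNoetherianRing (Localization.AtPrime p) :=
    IsLocalization.isNoetherianRing p.primeCompl _ inferInstance
  set q : Ideal R := p.comap φ.toRingHom
  set S := Localization.AtPrime q
  haveI : IsRegularLocalRing S := IsRegularRing.isRegularLocalRing_localization q
  -- `J = (ker φ) S` is prime
  haveI : (RingHom.ker φ.toRingHom).IsPrime := RingHom.ker_isPrime _
  have hdisj : Disjoint (q.primeCompl : Set R) (RingHom.ker φ.toRingHom) := by
    rw [Set.disjoint_left]
    intro x hx hxk
    apply hx
    change φ.toRingHom x ∈ p
    rw [RingHom.mem_ker.mp hxk]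
    exact p.zero_mem
  haveI : ((RingHom.ker φ.toRingHom).map (algebraMap R S)).IsPrime :=
    IsLocalization.isPrime_of_isPrime_disjoint q.primeCompl S _ inferInstance hdisj
  obtain ⟨e⟩ := exists_ringEquiv_localization_quotient_map_ker φ.toRingHom hφ p
  exact ringKrullDim_quotient_eq_of_mem_minimalPrimes_adicCompletion_of_ringEquiv _ e

end Literature.AlgebraicGeometry.Resolution
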